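import Mathlib
import Summits.MatrixMultiplication.MatrixMultiplication.Theorems.FidelityWitnessesFidelityGapThreeSeventeenStubFatBorderApolarityForms
import Summits.MatrixMultiplication.MatrixMultiplication.Theorems.FidelityWitnessesFidelityGapThreeSeventeenPunctualDefs

/-!
# Borel-fixed border apolarity at `(⟨3,3,3⟩, 17)` — part 4: apolarity of the `(1,1,1)` limit piece

Crux `stmt-MatrixMultiplication-4958` (`FidelityWitnesses.FidelityGapThreeSeventeen`), line
`punctual-saturation`, stub `stub_borelFixedApolarity` (helper file).

The `(1,1,1)`-piece of the Cox ring `S = ℂ[C ⊕ A ⊕ B]`: its monomials are exactly the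
`c_a a_b b_c` (`exists_eq_mono111`, `eq_sum_mono111`), so a `(1,1,1)`-form `F` over any coefficient
ring evaluates at a point `P` as `∑_{abc} F_{abc} P(c_a) P(a_b) P(b_c)` (`sum_eval_eq`).  Consequently
(**`pairT_map_constantCoeff_eq_zero`**, CHL 2023 §2.3 (i) in degree `(1,1,1)`): if `F ∈ S_{111} ⊗ ℂ[ε]`
vanishes at the `r` moving points of an order-`h` approximate decomposition
`∑_ρ u_ρ ⊗ v_ρ ⊗ w_ρ = ε^h T + O(ε^{h+1})` of `T = ⟨3,3,3⟩`, then
`0 = [ε^h] ∑_ρ F(p_ρ) = ⟨F(0), T⟩ = pairT (F(0))`; in the limit language of the line,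
**every element of `I_{111} = lim I(Γ_ε)_{111}` is apolar to `T`** (registered sub-goal
`stub_borelFixedApolarity_apolar`).

References: A. Conner, A. Harper, J. M. Landsberg, Forum Math. Pi 11 (2023) e17, §2.3 (i);
W. Buczyńska, J. Buczyński, Duke Math. J. 170 (2021), Thm 1.2. Everything proved.
-/

noncomputable section

namespace Summit.MatrixMultiplication.MatrixMultiplication.Theorems.PunctualSaturation

-- single-conjunct summit: the `Summit.<S>.<P>` prefix repeats `MatrixMultiplication` by design (D-0017)
set_option linter.dupNamespace false

open scoped BigOperators Polynomial
open MvPolynomial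
open Literature.Computability.AlgebraicComplexity
open Summit.MatrixMultiplication.MatrixMultiplication.Theorems.SymbolicSquare.FatBorder

namespace Apolar

/-! ## The monomials of weight `(1,1,1)` -/

/-- The `l`-th weight of a monomial is its degree in the slot-`l` variables. [folklore] -/
theorem weight_apply_slot (d : Var →₀ ℕ) (l : Fin 3) :
    Finsupp.weight wt d l = ∑ ij : Fin 3 × Fin 3, d (l, ij) := by
  rw [Finsupp.weight_apply, Finsupp.sum_fintype _ _ (fun _ => by simp), Finset.sum_apply,
    Fintype.sum_prod_type]
  simp only [wt, Pi.smul_apply, Pi.single_apply, smul_eq_mul, mul_ite, mul_one, mul_zero]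
  rw [Finset.sum_eq_single l (fun s _ hs => by simp [Ne.symm hs]) (fun h => absurd (Finset.mem_univ l) h)]
  simp

/-- **The monomials of weight `(1,1,1)` are the `c_a a_b b_c`.** [folklore] -/
theorem exists_eq_mono111 {d : Var →₀ ℕ} (hd : Finsupp.weight wt d = fun _ => 1) :
    ∃ a b c, d = mono111 a b c := by
  have h : ∀ l, ∑ ij : Fin 3 × Fin 3, d (l, ij) = 1 := fun l => by
    rw [← weight_apply_slot, hd]
  have key : ∀ l, ∃ ij₀, d (l, ij₀) = 1 ∧ ∀ ij, ij ≠ ij₀ → d (l, ij) = 0 := by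
    intro l
    obtain ⟨ij₀, -, hne⟩ := Finset.exists_ne_zero_of_sum_ne_zero
      (s := (Finset.univ : Finset (Fin 3 × Fin 3))) (f := fun ij => d (l, ij))
      (by rw [h l]; exact one_ne_zero)
    have hsplit := Finset.add_sum_erase Finset.univ (fun ij => d (l, ij)) (Finset.mem_univ ij₀)
    rw [h l] at hsplit
    have h1 : d (l, ij₀) = 1 := by
      have : d (l, ij₀) ≤ 1 := hsplit ▸ Nat.le_add_right _ _
      omega
    refine ⟨ij₀, h1, fun ij hij => ?_⟩
    have h0 : ∑ x ∈ Finset.univ.erase ij₀, d (l, x) = 0 := by omega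
    exact Finset.sum_eq_zero_iff.1 h0 ij (Finset.mem_erase.2 ⟨hij, Finset.mem_univ _⟩)
  choose g hg1 hg0 using key
  refine ⟨g 0, g 1, g 2, Finsupp.ext fun v => ?_⟩
  obtain ⟨s, ij⟩ := v
  by_cases hij : ij = g s
  · subst hij
    rw [hg1 s]
    fin_cases s <;> simp [mono111]
  · rw [hg0 s ij hij]
    fin_cases s <;> simp at hij <;> simp [mono111, Ne.symm hij]

/-- `mono111` is injective. [folklore] -/
theorem mono111_eq_iff {a b c a' b' c' : Fin 3 × Fin 3} :
    mono111 a b c = mono111 a' b' c' ↔ a = a' ∧ b = b' ∧ c = c' := by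
  constructor
  · intro h
    have ha := DFunLike.congr_fun h ((0 : Fin 3), a')
    have hb := DFunLike.congr_fun h ((1 : Fin 3), b')
    have hc := DFunLike.congr_fun h ((2 : Fin 3), c')
    simp only [mono111, Finsupp.add_apply, Finsupp.single_apply, Prod.mk.injEq] at ha hb hc
    simp only [true_and, if_true, Fin.isValue] at ha hb hc
    refine ⟨?_, ?_, ?_⟩
    · by_contra hne; simp [hne] at ha
    · by_contra hne; simp [hne] at hb
    · by_contra hne; simp [hne] at hc
  · rintro ⟨rfl, rfl, rfl⟩; rfl

variable {R : Type*} [CommSemiring R]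

/-- **A `(1,1,1)`-form is the sum of its `c_a a_b b_c`-terms.** [folklore] -/
theorem eq_sum_mono111 {F : MvPolynomial Var R}
    (hF : F ∈ weightedHomogeneousSubmodule R wt (fun _ => 1)) :
    F = ∑ a, ∑ b, ∑ c, monomial (mono111 a b c) (coeff (mono111 a b c) F) := by
  classical
  ext e
  simp only [coeff_sum, coeff_monomial]
  by_cases he : coeff e F = 0
  · rw [he]
    symm
    refine Finset.sum_eq_zero fun a _ => Finset.sum_eq_zero fun b _ => Finset.sum_eq_zero fun c _ => ?_
    split_ifs with h
    · rw [← h] at he; exact he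
    · rfl
  · obtain ⟨a₀, b₀, c₀, rfl⟩ := exists_eq_mono111 (hF he)
    simp only [mono111_eq_iff]
    simp [ite_and]

/-- Evaluating `x · c_a a_b b_c` at a point. [folklore] -/
theorem eval_monomial_mono111 (P : Var → R) (a b c : Fin 3 × Fin 3) (x : R) :
    eval P (monomial (mono111 a b c) x) = x * (P (0, a) * P (1, b) * P (2, c)) := by
  simp [mono111, eval_monomial, Finsupp.prod_add_index', pow_add, mul_assoc]

/-- **The sum of the values of a `(1,1,1)`-form at `r` points, through its coefficients and the
`(1,1,1)`-moments `∑_ρ P_ρ(c_a) P_ρ(a_b) P_ρ(b_c)` of the points.** [folklore] -/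
theorem sum_eval_eq {r : ℕ} (P : Fin r → Var → R) {F : MvPolynomial Var R}
    (hF : F ∈ weightedHomogeneousSubmodule R wt (fun _ => 1)) :
    ∑ ρ, eval (P ρ) F =
      ∑ a, ∑ b, ∑ c, coeff (mono111 a b c) F * ∑ ρ, P ρ (0, a) * P ρ (1, b) * P ρ (2, c) := by
  have hF' := eq_sum_mono111 hF
  conv_lhs => rw [hF']
  simp only [map_sum, eval_monomial_mono111, Finset.mul_sum]
  rw [Finset.sum_comm]
  refine Finset.sum_congr rfl fun a _ => ?_
  rw [Finset.sum_comm]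
  refine Finset.sum_congr rfl fun b _ => ?_
  rw [Finset.sum_comm]

/-! ## The `ε^h`-coefficient argument -/

/-- Reading off `[ε^h] (A · G) = A(0) · t` when `G = ε^h t + O(ε^{h+1})`. [folklore] -/
theorem coeff_mul_of_order {K : Type*} [CommSemiring K] {A G : K[X]} {h : ℕ} {t : K}
    (hG : ∀ j ≤ h, G.coeff j = if j = h then t else 0) : (A * G).coeff h = A.coeff 0 * t := by
  rw [Polynomial.coeff_mul, Finset.sum_eq_single (0, h)]
  · rw [hG h le_rfl, if_pos rfl]
  · rintro ⟨i, j⟩ hij hne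
    have hij' : i + j = h := by simpa using hij
    have hj : j ≠ h := fun hj => hne (by subst hj; simp_all)
    rw [hG j (by omega), if_neg hj, mul_zero]
  · intro hn
    exact absurd (by simp) hn

/-- **Apolarity of the vanishing `(1,1,1)`-forms in the limit** (CHL 2023 §2.3 (i) in degree
`(1,1,1)`): if `F ∈ S_{111} ⊗ ℂ[ε]` vanishes at the moving points of an order-`h` approximate
decomposition of `⟨3,3,3⟩`, then `F(0)` is apolar to `⟨3,3,3⟩`. [cite: ConnerHarperLandsberg2023, §2.3] -/
theorem pairT_map_constantCoeff_eq_zero {r h : ℕ} (p : Fin r → Var → ℂ[X])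
    (hp : IsApproxDecomposition h (matMulTensor ℂ 3 3 3) (fun ρ a => p ρ (0, a))
      (fun ρ b => p ρ (1, b)) (fun ρ c => p ρ (2, c)))
    {F : MvPolynomial Var ℂ[X]} (hF : F ∈ weightedHomogeneousSubmodule ℂ[X] wt (fun _ => 1))
    (hF0 : ∀ ρ, eval (p ρ) F = 0) :
    pairT (map (Polynomial.constantCoeff : ℂ[X] →+* ℂ) F) = 0 := by
  have hsum : ∑ ρ, eval (p ρ) F = 0 := Finset.sum_eq_zero fun ρ _ => hF0 ρ
  rw [sum_eval_eq p hF] at hsum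
  have hcoef := congrArg (fun P : ℂ[X] => P.coeff h) hsum
  simp only [Polynomial.finsetSum_coeff, Polynomial.coeff_zero] at hcoef
  unfold pairT
  simp only [coeff_map, Polynomial.constantCoeff_apply]
  rw [← hcoef]
  refine Finset.sum_congr rfl fun a _ => Finset.sum_congr rfl fun b _ =>
    Finset.sum_congr rfl fun c _ => ?_
  rw [coeff_mul_of_order (fun j hj => hp a b c j hj)]

/-- The `Ilim` form: **every element of `I_{111} = lim I(Γ_ε)_{111}` is apolar to `⟨3,3,3⟩`.**
[cite: ConnerHarperLandsberg2023, §2.3] -/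
theorem pairT_eq_zero_of_mem_Ilim {r h : ℕ} (p : Fin r → Var → ℂ[X])
    (hp : IsApproxDecomposition h (matMulTensor ℂ 3 3 3) (fun ρ a => p ρ (0, a))
      (fun ρ b => p ρ (1, b)) (fun ρ c => p ρ (2, c)))
    {f : S} (hf : f ∈ Ilim ℂ wt (fun _ => 1) p) : pairT f = 0 := by
  obtain ⟨F, hF, hF0, rfl⟩ := (mem_Ilim_iff (fun v : Var => by simp [wt])).1 hf
  exact pairT_map_constantCoeff_eq_zero p hp hF hF0

end Apolar

/-- **Registered sub-goal `stub_borelFixedApolarity_apolar` of `stub_borelFixedApolarity`**: a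
`(1,1,1)`-form over `ℂ[ε]` vanishing at the moving points of an order-`h` approximate decomposition
of `⟨3,3,3⟩` has constant term apolar to `⟨3,3,3⟩` (border apolarity, condition (i), degree
`(1,1,1)`). [cite: ConnerHarperLandsberg2023, §2.3] -/
theorem stub_borelFixedApolarity_apolar :
    ∀ (r h : ℕ) (p : Fin r → Var → Polynomial ℂ),
      IsApproxDecomposition h (matMulTensor ℂ 3 3 3) (fun ρ a => p ρ (0, a)) (fun ρ b => p ρ (1, b))
        (fun ρ c => p ρ (2, c)) →
      ∀ F : MvPolynomial Var (Polynomial ℂ),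
        F ∈ MvPolynomial.weightedHomogeneousSubmodule (Polynomial ℂ) wt (fun _ => 1) →
        (∀ ρ, MvPolynomial.eval (p ρ) F = 0) →
        pairT (MvPolynomial.map (Polynomial.constantCoeff : Polynomial ℂ →+* ℂ) F) = 0 :=
  fun _ _ p hp _ hF hF0 => Apolar.pairT_map_constantCoeff_eq_zero p hp hF hF0

end Summit.MatrixMultiplication.MatrixMultiplication.Theorems.PunctualSaturation

end
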